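import Literature.AnabelianGeometry.EtaleTheta.Discharge.Sec4Prop42SubHullClauses
import HarnessLib

/-!
# [EtTh] Prop. 4.2 (iii) ∧ (iv) at the FAITHFUL [FrdII] Def. 2.2 (ii) saturation slot over `B^temp(Π^tp_X)⁰` and the
# canonical base-category vocabulary `treeCatVocab` — node-level corollaries

S. Mochizuki, *The étale theta function and its Frobenioid-theoretic manifestations*, Publ. RIMS **45** (2009)
[MochizukiEtTh2009], §4, Prop. 4.2 (iii)/(iv), PDF pp.88–90; Def. 3.6 (ii) p.76 («divisorial monoid … on `D`»).
[cite: MochizukiEtTh2009, Prop 4.2 p.88]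

abc-iut cell, layer L2, DAG nodes `EtTh:Prop4.2(iii)` / `EtTh:Prop4.2(iv)`; seat abc-iut-w4-d044 (gen 5).  PROOF-ONLY (0
`def`s; nothing landed is edited or restated).  `Sec4Prop42SubHullClauses.lean` (this lineage, p466882) proved
`Prop42Sub.prop42_iii_iv_mkOfConnectedTemperoid_faithful`: [EtTh] Prop. 4.2 (iii) ∧ (iv) AS TYPED over the genuine connected
base with the `(N, H_⊙^{bs-fld})`-saturation slot of Def. 4.1 (iii)(a) INSTANTIATED by «the [FrdII] Def. 2.2 context
`def22Ctx A` (abc-iut-w6-d047) is `(N, H)`-saturated», ⟸ {`Φ` divisorial, `hDSpull`, `hR`} ∪ {B2 data `haug`/`act`/`hact`}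
∪ {[FrdII] Rmk. 2.2.1 ×2 at the instance BY NAME: `hex`, `h221`}.  Here:
* `…_faithful_treeCatVocab` — over abc-iut-L1's canonical base-category vocabulary `treeCatVocab` "`Φ` divisorial" is the
  Def. 3.6 (ii) FIELD of the tempered Frobenioid (`TemperedFrobenioid.isDivisorial_divisorMonoid`), so the floor reads
  ⟸ {`hDSpull` (GAP G-w5d063-1, [FrdI] Prop. 4.1 (iii)), `hR` (GAP G-w4d044-3, ERRATUM E2 root law)} ∪ {B2 data} ∪
  {[FrdII] Rmk. 2.2.1 ×2 BY NAME} — the two remaining GAP rows belong to other lineages; nothing of this lineage's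
  dictionary or laws is left;
* `prop42_iii_mkOfConnectedTemperoid_faithful_treeCatVocab` / `prop42_iv_…` — the two DAG nodes separately, for citation.
HONEST FRAMING: [EtTh]/[FrdI]/[FrdII] are refereed prerequisite papers; the binders are print's own hypotheses BY NAME, typed
≠ proved for them; nothing here bears on, or takes a side on, the disputed [IUTchIII] Cor. 3.12; nothing here asserts abc
proved or refuted.
-/

noncomputable section

namespace Literature.AnabelianGeometry.EtaleTheta

open CategoryTheory Opposite Literature.AlgebraicGeometry.Frobenioids Literature.AnabelianGeometry.SemiGraphs
  Literature.AlgebraicGeometry.Frobenioids.QuasiTemperoid.BTempConnected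

namespace BiKummerSetting

section FaithfulTreeCat

variable {K : Type} [Field K] (X : SemiGraphs.TemperedArithmeticGroup.{0} K) {D₀ : Type} [Category.{0} D₀]
  {V : FrdIMonoidStub.{0}} {T₀ : RealifiedDivisorMonoids (D₀ := D₀) V}
  {IsRational IsStrictlyRational : ((ConnectedPart (BTemp X.Pi))ᵒᵖ ⥤ CommMonCat.{0}) → Prop}
  (tf : TemperedFrobenioid T₀ (ConnectedPart (BTemp X.Pi))
    (treeCatVocab (ConnectedPart (BTemp X.Pi)) IsRational IsStrictlyRational))
  (hZ : tf.monoidType = MonoidType.Z) (hP : ∀ A : (ConnectedPart (BTemp X.Pi))ᵒᵖ, IsPerfect (tf.Φ.carrier A))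
  (haug : IsOpenMap X.aug)
  (act : ∀ A : tf.category, MulDistribMulAction (Aut (TemperedFrobenioid.AE X tf haug A)) ↥(tf.units A))
  (hact : ∀ (A : tf.category) (α : Aut A) (u : ↥(tf.units A)), (TemperedFrobenioid.resE X tf haug A α) • u =
    (⟨α * u.1 * α⁻¹, (tf.units_normal A).conj_mem _ u.2 α⟩ : ↥(tf.units A)))
  (A₀ : tf.category) (hA₀ : PreFrobenioid.IsFrobeniusTrivial tf.toElem A₀) (hA₀' : SemiGraphs.IsGaloisObj A₀.base.obj)
  (hDSpull : ∀ {A A' : ConnectedPart (BTemp X.Pi)} (e : A' ⟶ A) {a b : tf.Φ.carrier (op A)},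
    (∀ x : tf.Φ.carrier (op A), x ∣ a → x ∣ b → x = 1) →
      ∀ y : tf.Φ.carrier (op A'), y ∣ pull tf.divisorMonoid e a → y ∣ pull tf.divisorMonoid e b → y = 1)
  (hR : ∀ (N : ℕ+) (A : ConnectedPart (BTemp X.Pi)), SemiGraphs.IsGaloisObj A.obj →
    ∀ f : tf.ratFnFunctor.obj (op A),
      ∃ (A' : ConnectedPart (BTemp X.Pi)) (_ : SemiGraphs.IsGaloisObj A'.obj) (b : A' ⟶ A)
        (g : tf.ratFnFunctor.obj (op A')), g ^ (N : ℕ) = pull tf.ratFnFunctor b f)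
  (hex : ∀ (A' : tf.category) (N : ℕ+), ∃ (A'' : tf.category) (ψ : A'' ⟶ A'),
    PreFrobenioid.IsPullbackMorphism tf.toElem ψ ∧
      PadicKummer.IsNHSaturated (TemperedFrobenioid.def22Ctx X tf haug A'' (act A'') (hact A'')
        (mkOfConnectedTemperoid X tf hZ hP (fun H A N => ∃ (hn : H.Normal)
            (ho : IsOpen (H : Set (Field.absoluteGaloisGroup K))),
            PadicKummer.IsNHSaturated (TemperedFrobenioid.def22Ctx X tf haug A (act A) (hact A) H hn ho) N)
          A₀ hA₀ hA₀').HodotBsFld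
        (mkOfConnectedTemperoid X tf hZ hP (fun _ _ _ => True) A₀ hA₀ hA₀').hodotBsFld_normal
        ((mkOfConnectedTemperoid X tf hZ hP (fun _ _ _ => True) A₀ hA₀ hA₀').isOpen_hodotBsFld_of_isOpenMap
          (isOpen_Hodot_mkOfConnectedTemperoid X tf hZ hP _ A₀ hA₀ hA₀') haug)) N)
  (h221 : ∀ (A'' : tf.category) (N : ℕ+), (A''.base ⟶ A₀.base) → PreFrobenioid.IsFrobeniusTrivial tf.toElem A'' →
    PadicKummer.SaturatedInvariantsAdmitRoots (TemperedFrobenioid.def22Ctx X tf haug A'' (act A'') (hact A'')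
        (mkOfConnectedTemperoid X tf hZ hP (fun H A N => ∃ (hn : H.Normal)
            (ho : IsOpen (H : Set (Field.absoluteGaloisGroup K))),
            PadicKummer.IsNHSaturated (TemperedFrobenioid.def22Ctx X tf haug A (act A) (hact A) H hn ho) N)
          A₀ hA₀ hA₀').HodotBsFld
        (mkOfConnectedTemperoid X tf hZ hP (fun _ _ _ => True) A₀ hA₀ hA₀').hodotBsFld_normal
        ((mkOfConnectedTemperoid X tf hZ hP (fun _ _ _ => True) A₀ hA₀ hA₀').isOpen_hodotBsFld_of_isOpenMap
          (isOpen_Hodot_mkOfConnectedTemperoid X tf hZ hP _ A₀ hA₀ hA₀') haug)) N)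

include hDSpull hR hex h221

/-- **[EtTh] Prop. 4.2 (iii) ∧ (iv) AS TYPED over `B^temp(Π^tp_X)⁰` and `treeCatVocab`, AT THE FAITHFUL [FrdII] Def. 2.2 (ii)
SATURATION SLOT** — "`Φ` divisorial" being the Def. 3.6 (ii) field: ⟸ {`hDSpull` (G-w5d063-1), `hR` (G-w4d044-3)} ∪
{B2 data `haug`/`act`/`hact`} ∪ {[FrdII] Rmk. 2.2.1 ×2 AT THE INSTANCE BY NAME: `hex`, `h221`}.
[cite: MochizukiEtTh2009, Prop 4.2 p.88] -/
theorem Prop42Sub.prop42_iii_iv_mkOfConnectedTemperoid_faithful_treeCatVocab :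
    (mkOfConnectedTemperoid X tf hZ hP (fun H A N => ∃ (hn : H.Normal)
          (ho : IsOpen (H : Set (Field.absoluteGaloisGroup K))),
          PadicKummer.IsNHSaturated (TemperedFrobenioid.def22Ctx X tf haug A (act A) (hact A) H hn ho) N)
        A₀ hA₀ hA₀').Prop42_iii (fun {_ _} φ x => tf.pullFracModel φ x) ∧
      (mkOfConnectedTemperoid X tf hZ hP (fun H A N => ∃ (hn : H.Normal)
          (ho : IsOpen (H : Set (Field.absoluteGaloisGroup K))),
          PadicKummer.IsNHSaturated (TemperedFrobenioid.def22Ctx X tf haug A (act A) (hact A) H hn ho) N)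
        A₀ hA₀ hA₀').Prop42_iv (fun φ x => tf.pullFracModel φ x) :=
  Prop42Sub.prop42_iii_iv_mkOfConnectedTemperoid_faithful X tf hZ hP haug act hact A₀ hA₀ hA₀'
    tf.isDivisorial_divisorMonoid hDSpull hR hex h221

/-- **DAG node `EtTh:Prop4.2(iii)` over `B^temp(Π^tp_X)⁰` / `treeCatVocab` at the faithful saturation slot** (first
component of `…_faithful_treeCatVocab`). [cite: MochizukiEtTh2009, Prop 4.2 p.88] -/
theorem prop42_iii_mkOfConnectedTemperoid_faithful_treeCatVocab :
    (mkOfConnectedTemperoid X tf hZ hP (fun H A N => ∃ (hn : H.Normal)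
          (ho : IsOpen (H : Set (Field.absoluteGaloisGroup K))),
          PadicKummer.IsNHSaturated (TemperedFrobenioid.def22Ctx X tf haug A (act A) (hact A) H hn ho) N)
        A₀ hA₀ hA₀').Prop42_iii (fun {_ _} φ x => tf.pullFracModel φ x) :=
  (Prop42Sub.prop42_iii_iv_mkOfConnectedTemperoid_faithful_treeCatVocab X tf hZ hP haug act hact A₀ hA₀ hA₀' hDSpull hR
    hex h221).1

/-- **DAG node `EtTh:Prop4.2(iv)` over `B^temp(Π^tp_X)⁰` / `treeCatVocab` at the faithful saturation slot** (second
component of `…_faithful_treeCatVocab`). [cite: MochizukiEtTh2009, Prop 4.2 p.89] -/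
theorem prop42_iv_mkOfConnectedTemperoid_faithful_treeCatVocab :
    (mkOfConnectedTemperoid X tf hZ hP (fun H A N => ∃ (hn : H.Normal)
          (ho : IsOpen (H : Set (Field.absoluteGaloisGroup K))),
          PadicKummer.IsNHSaturated (TemperedFrobenioid.def22Ctx X tf haug A (act A) (hact A) H hn ho) N)
        A₀ hA₀ hA₀').Prop42_iv (fun φ x => tf.pullFracModel φ x) :=
  (Prop42Sub.prop42_iii_iv_mkOfConnectedTemperoid_faithful_treeCatVocab X tf hZ hP haug act hact A₀ hA₀ hA₀' hDSpull hR
    hex h221).2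

end FaithfulTreeCat

end BiKummerSetting

end Literature.AnabelianGeometry.EtaleTheta

end
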